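import Summits.BirchSwinnertonDyer.BirchSwinnertonDyer.Theorems.ThetaPartnerAtTwoSignedMainConjectureCMTwoRankZeroLowerOffTwoFineDual
import Summits.BirchSwinnertonDyer.BirchSwinnertonDyer.Theorems.ThetaPartnerAtTwoSignedKatoUpToAtTwoLocalDualTranspose
import Summits.BirchSwinnertonDyer.BirchSwinnertonDyer.Theorems.ThetaPartnerAtTwoSignedKatoUpToAtTwoFineStrictRat
import Literature.NumberTheory.EllipticCurves.KatoRankBoundAllPrimesSkeletonProofs
import HarnessLib

/-!
# Route `ThetaPartnerAtTwo` (TP2), crux K2R0P♭ `SignedMainConjectureCMTwoRankZeroOfPubOfFlat` (stmt-BirchSwinnertonDyer-26471; derived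
# node K2r0P stmt-BirchSwinnertonDyer-24945), line `rankzero` v16, stub (LDℓ)_A `stub_signedLowerLengthCMTwo`:
# the `2`-ROBUST LOWER four-term door, and the lower package in the PINNED-LOCAL-DUAL currency with clause (c) DISCHARGED

HONEST FRAMING (cell `pub/bsd-wall`, W-ALL row 1; width seat `bsd-wall-tp2-p2-w2` g3, `--supports` only; the lead lineage `bsd-wall-tp2-p2`
holds the item). THEOREMS ONLY — no definition, no named fact, no instance, no `sorry`; route-independent (no `Theses`/`Cruxes` import: the
conclusion (LDℓ)_A is written out verbatim); this file closes no item; the crux is NOT proved; BSD is NOT proved by any of this.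

## Why this file (port spec `Cruxes/SignedMainConjectureCMTwoRankZeroOfPub/LOWER-LENGTH-SOCKET-w2g2.md` §5, clauses (a′)(b)(c)(e)(f)(g))

The w2 g2 door `SignedLowerOffTwo.offTwoLower_of_lowerColemanPackageTwo_toFineDual` (p613293) takes an EXACT lower package on a
submodule `P ≤ Λ`: `ker j ≤ range col` exactly, `k ∘ j = 0` exactly, `col` injective (from GZK), `ℓ_𝔭(X₀) < ⊤`. The sister crux K3 receives
its `2`-adic objects only UP TO `C(2)^m`-torsion on an ABSTRACT local module `P` with a map `ι : P → Λ` (`SignedKatoOffTwo.fourTerm_lengthAt_le_upTo`,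
file `…KatoUpToAtTwoOffTwoRobust`: the `Δ = {±1}` descent `ℚ(μ_{2^∞}) → ℚ_∞`, a Coleman map at `2` with `2`-power defects). This file is the
LOWER twin in that currency (§1–§2), and reads the lower package in the K3 width seats' pinned-local-dual frame
(`SignedKatoOffTwo.LocalChar`, file `…KatoUpToAtTwoLocalDualTranspose`), where the map `j : P → X⁺` is THE `Λ`-linear transpose of a
local restriction `r` and clause (c) `k ∘ j = 0` becomes a THEOREM (§3: fine Selmer classes are locally trivial at the prime above `2`,
`SignedKatoOffTwo.FineStrictRat.resOfLe_eq_zero_of_mem_fineSelmerInfty_rat`).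

KERNEL FINDING (§1): the LOWER half of the four-term bookkeeping needs NONE of «`ker ι` killed by `2^m`», «`col` injective» (so no
Gross–Zagier–Kolyvagin), «`X⁺` torsion», «`ℓ_𝔭(X₀) < ⊤`»: only (b♭) `j y = 0 ⟹ u·y ∈ range col`, (c♭) `u·k(j y) = 0`, `k` onto, and then
`ℓ_𝔭(Y) + ℓ_𝔭(Λ/(ι col z)) ≤ ℓ_𝔭(X) + ℓ_𝔭(𝐇¹/Λz) + ℓ_𝔭(Λ/ι(P))` in `ℕ∞` — every step is a `≤`, nothing is cancelled.

## What is proved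

* §1 (any commutative ring `R`, `u ∉ 𝔭`) `fourTerm_lengthAt_ge_upTo`, `lengthAt_quotient_le_of_fourTerm_ge_upTo` — the `≥` half of Kato's
  §17.13 / Kobayashi's Thm. 7.4 bookkeeping with (b),(c) only up to `u`-torsion, on `H →ᶜ P →ʲ X →ᵏ Y`, `ι : P → R`.
* §2 `offTwoLower_of_lowerRobustPackageTwo` — (LDℓ)_A from a `2`-ROBUST lower package per `(D, 𝔭 ∌ 2)`: pinned `I = 𝐇¹_Γ(T₂A)`, abstract
  `P` with `ι : P → Λ`, `col : 𝐇¹ → P`, `j : P → X⁺`, `s ∈ 𝐇¹`, `m`, with (b♭) `j y = 0 ⟹ C(2)^m y ∈ range col`, (c♭) `C(2)^m · k (j y) = 0` for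
  the handed transpose `k : X⁺ ↠ X₀`, (e) `ℓ_𝔭(Λ/ι(P)) = 0`, (f) `ℓ_𝔭(Λ/(L♭)) ≤ ℓ_𝔭(Λ/(ι col s))`, (g) `ℓ_𝔭(𝐇¹/Λs) ≤ ℓ_𝔭(X₀)`. PUB-free.
* §3 `offTwoLower_of_pinnedLocalDualPackageTwo` — the same with `j` CONSTRUCTED and (c) PROVED: the provider gives, per `(D, 𝔭)`, any abelian
  group `S'` with an additive `r : Sel⁺(A/ℚ_∞) → S'` killing the classes with `res_𝔭 = 0` (e.g. `res_𝔭` itself, or Kummer coordinates of it)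
  and an endomorphism `ψ'` intertwining `conj_γ`, a pinned local dual `(P, dP : P → Hom(S', ℚ/ℤ))` (`T` through `ψ' − 1`, constants through
  `ℤ₂ → ℤ/2^k`), `ι`, `col`, `s`, `m` with (PT♭) «`dP y` vanishes on `r(Sel⁺_∞)` ⟹ `C(2)^m y ∈ range col`» — the deep Poitou–Tate half, now the
  ONLY global clause — and (e), (f), (g).

References: [Kobayashi2003] Thm. 6.2–6.3 (p. 11), (7.17)–(7.21), Thm. 7.3, proof of Thm. 7.4 (pp. 12–13), (8.23) (p. 18); [Kato2004Asterisque]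
Conj. 12.10 (p. 224), Lemma 15.13, (15.16.1) (pp. 264–265), §17.13 (p. 280); [GreenbergLNM1716] §1–2; [Greenberg1989] §1 p. 98;
[Bourbaki1989CommAlg] Ch. II §2.4.
-/

set_option autoImplicit false
-- the Theorems namespace of this sub repeats the summit name by design (D-0017 nested layout)
set_option linter.dupNamespace false

noncomputable section

open scoped Classical NumberField MatrixGroups ModularForm

open NumberField IsDedekindDomain CongruenceSubgroup

namespace Summit.BirchSwinnertonDyer.BirchSwinnertonDyer.Theorems

open Literature.NumberTheory.EllipticCurves Literature.NumberTheory.GaloisRepresentations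
  WeierstrassCurve ZpExtension Literature.NumberTheory.EllipticCurves.Kobayashi2003
  Literature.NumberTheory.EllipticCurves.Module Literature.NumberTheory.EllipticCurves.Kato2004
  Literature.NumberTheory.EllipticCurves.IwasawaDual Literature.NumberTheory.EllipticCurves.GreenbergSelmer
  Literature.NumberTheory.EllipticCurves.ModularForms Literature.NumberTheory.EllipticCurves.Rank1Residual
  Literature.NumberTheory.EllipticCurves.Rank1Residual.Typed
  Summit.BirchSwinnertonDyer.Rank1Residual Summit.BirchSwinnertonDyer.Rank1Residual.Supersingular

namespace SignedLowerOffTwo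

/-! ## §1 The reverse four-term inequality when (b), (c) hold only up to `u`-torsion, `u ∉ 𝔭` -/

section Robust

variable {R : Type*} [CommRing R] {H P X Y : Type*} [AddCommGroup H] [_root_.Module R H]
  [AddCommGroup P] [_root_.Module R P] [AddCommGroup X] [_root_.Module R X]
  [AddCommGroup Y] [_root_.Module R Y]

/-- `ℓ_𝔭(P/c(N)) ≤ ℓ_𝔭(H/N) + ℓ_𝔭(P/range c)` for ANY linear `c : H → P` and `N ≤ H` (`0 → range c/c(N) → P/c(N) → P/range c → 0`
and `H/N ↠ range c/c(N)`; no injectivity). [folklore] -/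
private theorem lengthAt_quotient_map_le_add (c : H →ₗ[R] P) (N : Submodule R H) (𝔭 : PrimeSpectrum R) :
    lengthAt R (P ⧸ Submodule.map c N) 𝔭 ≤
      lengthAt R (H ⧸ N) 𝔭 + lengthAt R (P ⧸ LinearMap.range c) 𝔭 := by
  set M : Submodule R P := Submodule.map c N with hM
  let φ : H →ₗ[R] P ⧸ M := M.mkQ ∘ₗ c
  have hrangeφ : LinearMap.range φ = (LinearMap.range c).map M.mkQ := LinearMap.range_comp _ _
  have hMle : M ≤ LinearMap.range c := by
    rw [hM, LinearMap.range_eq_map]; exact Submodule.map_mono le_top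
  have hNφ : N ≤ LinearMap.ker φ.rangeRestrict := fun x hx ↦ by
    rw [LinearMap.mem_ker]
    refine Subtype.ext ?_
    rw [LinearMap.codRestrict_apply, LinearMap.comp_apply, Submodule.mkQ_apply, ZeroMemClass.coe_zero,
      Submodule.Quotient.mk_eq_zero]
    exact Submodule.mem_map_of_mem hx
  have hsurj : Function.Surjective (N.liftQ φ.rangeRestrict hNφ) := by
    rintro ⟨_, x, rfl⟩
    exact ⟨Submodule.Quotient.mk x, rfl⟩
  have h1 : lengthAt R (LinearMap.range φ) 𝔭 ≤ lengthAt R (H ⧸ N) 𝔭 := lengthAt_le_of_surjective _ hsurj 𝔭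
  rw [lengthAt_eq_add_quotient (LinearMap.range φ) 𝔭]
  refine add_le_add h1 (le_of_eq ?_)
  rw [lengthAt_eq_of_linearEquiv (Submodule.quotEquivOfEq _ _ hrangeφ) 𝔭,
    lengthAt_eq_of_linearEquiv (Submodule.quotientQuotientEquivQuotient M (LinearMap.range c) hMle) 𝔭]

/-- `ℓ_𝔭(R/(ι(c z))) ≤ ℓ_𝔭(P/c(Rz)) + ℓ_𝔭(R/range ι)` for ANY linear `ι : P → R` (`ι` induces `P/c(Rz) ↠ (ι(P) + (ι c z))/(ι c z)` and
the cokernel of that inside `R/(ι c z)` is a quotient of `R/ι(P)`; no injectivity). [folklore] -/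
private theorem lengthAt_quotient_span_le_add (ι : P →ₗ[R] R) (c : H →ₗ[R] P) (z : H) (𝔭 : PrimeSpectrum R) :
    lengthAt R (R ⧸ Ideal.span {ι (c z)}) 𝔭 ≤
      lengthAt R (P ⧸ Submodule.map c (Submodule.span R {z})) 𝔭 + lengthAt R (R ⧸ LinearMap.range ι) 𝔭 := by
  set Nz : Submodule R R := Ideal.span {ι (c z)} with hNz
  let ψ : P →ₗ[R] R ⧸ Nz := Nz.mkQ ∘ₗ ι
  have hrangeψ : LinearMap.range ψ = (LinearMap.range ι).map Nz.mkQ := LinearMap.range_comp _ _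
  have hNzle : Nz ≤ LinearMap.range ι := by
    rw [hNz, Ideal.span_singleton_le_iff_mem]
    exact ⟨c z, rfl⟩
  -- `c(Rz) ≤ ker ψ`
  have hle : Submodule.map c (Submodule.span R {z}) ≤ LinearMap.ker ψ := by
    rw [Submodule.map_span, Set.image_singleton, Submodule.span_singleton_le_iff_mem, LinearMap.mem_ker,
      LinearMap.comp_apply, Submodule.mkQ_apply, Submodule.Quotient.mk_eq_zero, hNz]
    exact Ideal.subset_span rfl
  have h1 : lengthAt R (LinearMap.range ψ) 𝔭 ≤ lengthAt R (P ⧸ Submodule.map c (Submodule.span R {z})) 𝔭 := by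
    rw [← lengthAt_eq_of_linearEquiv ψ.quotKerEquivRange 𝔭]
    exact lengthAt_le_of_surjective (Submodule.factor hle) (Submodule.factor_surjective hle) 𝔭
  rw [lengthAt_eq_add_quotient (LinearMap.range ψ) 𝔭]
  refine add_le_add h1 (le_of_eq ?_)
  rw [lengthAt_eq_of_linearEquiv (Submodule.quotEquivOfEq _ _ hrangeψ) 𝔭,
    lengthAt_eq_of_linearEquiv (Submodule.quotientQuotientEquivQuotient Nz (LinearMap.range ι) hNzle) 𝔭]

/-- **The reverse four-term inequality up to `u`-torsion.** Let `R` be a commutative ring, `𝔭` a prime, `u ∉ 𝔭`, and `H →ᶜ P →ʲ X →ᵏ Y`,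
`ι : P → R` linear maps with: (b♭) `u · y ∈ range c` whenever `j y = 0` (the DEEP Poitou–Tate half up to `u`); (c♭) `u · k (j y) = 0` for
all `y` (the complex half at `X` up to `u`); `k` onto. Then for every `z ∈ H`:
`ℓ_𝔭(Y) + ℓ_𝔭(R/(ι(c z))) ≤ ℓ_𝔭(X) + ℓ_𝔭(H/Rz) + ℓ_𝔭(R/range ι)` in `ℕ∞`. NO hypothesis on `ker ι`, `ker c`, torsion or finiteness:
(A) `ℓ(X) = ℓ(ker k) + ℓ(Y)`; (B) `ℓ(range j) ≤ ℓ(ker k)` (`u · range j ⊆ ker k`); (C) `ℓ(P/range c) ≤ ℓ(P/ker j) = ℓ(range j)`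
(`u · ker j ⊆ range c`); (D) `ℓ(P/c(Rz)) ≤ ℓ(H/Rz) + ℓ(P/range c)`; (E) `ℓ(R/(ι c z)) ≤ ℓ(P/c(Rz)) + ℓ(R/range ι)`. With `u = 1`, `ι`, `c`
injective this is `fourTerm_lengthAt_ge`; it is the `≥` twin of `SignedKatoOffTwo.fourTerm_lengthAt_le_upTo`.
[cite: Kato2004Asterisque, §17.13 (p. 280)] [cite: Kobayashi2003, (7.17)–(7.21) and proof of Thm. 7.4 (pp. 12–13)]
[cite: Bourbaki1989CommAlg, Ch. II §2.4] -/
theorem fourTerm_lengthAt_ge_upTo (ι : P →ₗ[R] R) (c : H →ₗ[R] P) (j : P →ₗ[R] X) (k : X →ₗ[R] Y)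
    {u : R} (𝔭 : PrimeSpectrum R) (hu : u ∉ 𝔭.asIdeal)
    (hjc : ∀ y, j y = 0 → u • y ∈ LinearMap.range c) (hkj : ∀ y, u • k (j y) = 0)
    (hk : Function.Surjective k) (z : H) :
    lengthAt R Y 𝔭 + lengthAt R (R ⧸ Ideal.span {ι (c z)}) 𝔭 ≤
      lengthAt R X 𝔭 + lengthAt R (H ⧸ Submodule.span R {z}) 𝔭 + lengthAt R (R ⧸ LinearMap.range ι) 𝔭 := by
  -- (A) `ℓ(X) = ℓ(ker k) + ℓ(Y)`
  have hX : lengthAt R X 𝔭 = lengthAt R (LinearMap.ker k) 𝔭 + lengthAt R Y 𝔭 := by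
    rw [lengthAt_eq_add_quotient (LinearMap.ker k) 𝔭, lengthAt_eq_of_linearEquiv (k.quotKerEquivOfSurjective hk) 𝔭]
  -- (B) `ℓ(range j) ≤ ℓ(ker k)`
  have hB : lengthAt R (LinearMap.range j) 𝔭 ≤ lengthAt R (LinearMap.ker k) 𝔭 := by
    refine lengthAt_le_of_smul_mem 𝔭 hu ?_
    rintro _ ⟨y, rfl⟩
    rw [LinearMap.mem_ker, map_smul]
    exact hkj y
  -- (C) `ℓ(P/range c) ≤ ℓ(P/ker j) = ℓ(range j)`
  have hC : lengthAt R (P ⧸ LinearMap.range c) 𝔭 ≤ lengthAt R (LinearMap.range j) 𝔭 := by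
    rw [← lengthAt_eq_of_linearEquiv j.quotKerEquivRange 𝔭]
    exact lengthAt_quotient_le_of_smul_mem 𝔭 hu fun y hy ↦ hjc y hy
  -- (D), (E)
  have hD := lengthAt_quotient_map_le_add c (Submodule.span R {z}) 𝔭
  have hE := lengthAt_quotient_span_le_add ι c z 𝔭
  calc lengthAt R Y 𝔭 + lengthAt R (R ⧸ Ideal.span {ι (c z)}) 𝔭
      ≤ lengthAt R Y 𝔭 + (lengthAt R (H ⧸ Submodule.span R {z}) 𝔭 + lengthAt R (LinearMap.ker k) 𝔭 +
          lengthAt R (R ⧸ LinearMap.range ι) 𝔭) :=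
        add_le_add le_rfl (hE.trans (add_le_add (hD.trans (add_le_add le_rfl (hC.trans hB))) le_rfl))
    _ = lengthAt R X 𝔭 + lengthAt R (H ⧸ Submodule.span R {z}) 𝔭 + lengthAt R (R ⧸ LinearMap.range ι) 𝔭 := by
        rw [hX]; ring

/-- **`ℓ_𝔭(R/(L)) ≤ ℓ_𝔭(X)` from a reverse four-term package up to `u`-torsion — no cancellation.** In the situation of
`fourTerm_lengthAt_ge_upTo`, if `ℓ_𝔭(R/range ι) = 0` ((e): `ι` onto at `𝔭`), `ℓ_𝔭(R/(L)) ≤ ℓ_𝔭(R/(ι(c z)))` ((f): `L ∣ ι(c z)` at `𝔭`) and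
`ℓ_𝔭(H/Rz) ≤ ℓ_𝔭(Y)` ((g): the lower half of a main conjecture without `L`-functions at `𝔭`), then `ℓ_𝔭(R/(L)) ≤ ℓ_𝔭(X)`:
`ℓ(R/(L)) ≤ ℓ(R/(ι c z)) ≤ ℓ(P/c(Rz)) ≤ ℓ(H/Rz) + ℓ(P/range c) ≤ ℓ(Y) + ℓ(ker k) = ℓ(X)`; `ℓ_𝔭(Y)` may be infinite.
[cite: Kobayashi2003, proof of Thm. 7.4 (p. 13)] [cite: Kato2004Asterisque, §17.13 (p. 280)] -/
theorem lengthAt_quotient_le_of_fourTerm_ge_upTo (ι : P →ₗ[R] R) (c : H →ₗ[R] P) (j : P →ₗ[R] X) (k : X →ₗ[R] Y)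
    {u : R} (𝔭 : PrimeSpectrum R) (hu : u ∉ 𝔭.asIdeal)
    (hjc : ∀ y, j y = 0 → u • y ∈ LinearMap.range c) (hkj : ∀ y, u • k (j y) = 0)
    (hk : Function.Surjective k) (z : H) {L : R}
    (hcoker : lengthAt R (R ⧸ LinearMap.range ι) 𝔭 = 0)
    (hL : lengthAt R (R ⧸ Ideal.span {L}) 𝔭 ≤ lengthAt R (R ⧸ Ideal.span {ι (c z)}) 𝔭)
    (hz : lengthAt R (H ⧸ Submodule.span R {z}) 𝔭 ≤ lengthAt R Y 𝔭) :
    lengthAt R (R ⧸ Ideal.span {L}) 𝔭 ≤ lengthAt R X 𝔭 := by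
  have hX : lengthAt R X 𝔭 = lengthAt R (LinearMap.ker k) 𝔭 + lengthAt R Y 𝔭 := by
    rw [lengthAt_eq_add_quotient (LinearMap.ker k) 𝔭, lengthAt_eq_of_linearEquiv (k.quotKerEquivOfSurjective hk) 𝔭]
  have hB : lengthAt R (LinearMap.range j) 𝔭 ≤ lengthAt R (LinearMap.ker k) 𝔭 := by
    refine lengthAt_le_of_smul_mem 𝔭 hu ?_
    rintro _ ⟨y, rfl⟩
    rw [LinearMap.mem_ker, map_smul]
    exact hkj y
  have hC : lengthAt R (P ⧸ LinearMap.range c) 𝔭 ≤ lengthAt R (LinearMap.range j) 𝔭 := by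
    rw [← lengthAt_eq_of_linearEquiv j.quotKerEquivRange 𝔭]
    exact lengthAt_quotient_le_of_smul_mem 𝔭 hu fun y hy ↦ hjc y hy
  have hD := lengthAt_quotient_map_le_add c (Submodule.span R {z}) 𝔭
  have hE := lengthAt_quotient_span_le_add ι c z 𝔭
  rw [hcoker, add_zero] at hE
  calc lengthAt R (R ⧸ Ideal.span {L}) 𝔭
      ≤ lengthAt R (P ⧸ Submodule.map c (Submodule.span R {z})) 𝔭 := hL.trans hE
    _ ≤ lengthAt R Y 𝔭 + lengthAt R (LinearMap.ker k) 𝔭 := hD.trans (add_le_add hz (hC.trans hB))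
    _ = lengthAt R X 𝔭 := by rw [hX, add_comm]

/-- A power of an element outside a prime ideal is outside it. [folklore] -/
private theorem pow_not_mem (𝔭 : PrimeSpectrum R) {u : R} (hu : u ∉ 𝔭.asIdeal) (m : ℕ) : u ^ m ∉ 𝔭.asIdeal :=
  fun h ↦ hu (𝔭.isPrime.mem_of_pow_mem m h)

end Robust

/-! ## §2 `p = 2`: (LDℓ)_A from a `2`-ROBUST lower package on an abstract local module -/

section AtTwo

/-- **(LDℓ)_A from a `2`-ROBUST LOWER package (abstract local module; PUB-free).** If for every CM `A/ℚ` (globally minimal) of analytic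
rank `0`, good supersingular at `2`, `a₂ = 0`, `2 ∣ #Ш(A)·∏c_ℓ(A)`, every cyclotomic datum matching the variable, newform, period ratio,
Pollack pair `(L♯, L♭)` at `2`, dual datum `D` of `Sel⁺(A/ℚ_∞)` with `X⁺` torsion, EVERY fine dual datum `Y` with a `Λ`-linear SURJECTIVE
`k : X⁺ → X₀` transposing `Sel₀ ≤ Sel⁺`, and every height-one `𝔭 ∌ 2`, there are a pinned `I = 𝐇¹_Γ(T₂A)`, an ABSTRACT `Λ`-module `P`
with `ι : P → Λ`, `col : 𝐇¹ → P`, `j : P → X⁺`, `s ∈ 𝐇¹`, `m ∈ ℕ` with (b♭) `j y = 0 ⟹ C(2)^m·y ∈ range col`, (c♭) `C(2)^m · k (j y) = 0`,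
(e) `ℓ_𝔭(Λ/ι(P)) = 0`, (f) `ℓ_𝔭(Λ/(L♭)) ≤ ℓ_𝔭(Λ/(ι col s))`, (g) `ℓ_𝔭(𝐇¹/Λs) ≤ ℓ_𝔭(X₀)`, THEN (LDℓ)_A. Nothing else: no injectivity
of `col` or `ι`, no Gross–Zagier–Kolyvagin, no finiteness (§1). The transpose `k` exists and is onto
(`SignedSelmerDualData.exists_linearMap_toFineDual`), a fine dual datum exists (`nonempty_fineSelmerDualData`), `ContinuousSMul ℤ₂ T₂A` is
`TateModule.continuousSMul_padicInt`. [cite: Kobayashi2003, Thm. 6.2–6.3 (p. 11), (7.21), proof of Thm. 7.4 (p. 13)]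
[cite: Kato2004Asterisque, Conj. 12.10 (p. 224), Lemma 15.13 and (15.16.1) (pp. 264–265), §17.13 (p. 280)] -/
theorem offTwoLower_of_lowerRobustPackageTwo
    (hPkg : ∀ (A : WeierstrassCurve ℚ) [A.IsElliptic] [A.IsGloballyMinimal],
      A.HasCM → A.analyticRank = 0 → GoodSS A 2 → A.frobeniusTrace 2 = 0 →
      2 ∣ A.shaOrder * A.tamagawaProduct →
      ∀ (κ : ZpExtension ℚ 2) (γ : Field.absoluteGaloisGroup ℚ),
        κ.IsCyclotomic → κ.IsTopGenerator γ → IsCyclotomicVariable 2 γ →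
      ∀ [NeZero (A.conductorNorm ℤ)] (f : CuspForm (Gamma0 (A.conductorNorm ℤ)) 2),
        IsNewformOf A f → ∀ (ϖ : ℚ), (ϖ : ℝ) * A.realPeriodRat = plusPeriod f →
      ∀ (Lplus Lminus : IwasawaAlgebra 2), IsPollackPair f 2 Lplus Lminus →
      ∀ (D : SignedSelmerDualData A κ γ 1) [ContinuousSMul ℤ_[2] (A.tateModule 2)],
        Module.IsTorsion (IwasawaAlgebra 2) D.X →
      ∀ (Y : A.FineSelmerDualData κ γ) (k : D.X →ₗ[IwasawaAlgebra 2] Y.X), Function.Surjective k →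
        (∀ (x : D.X) (s : A.fineSelmerInfty κ),
          Y.toDual (k x) s = D.toDual x (AddSubgroup.inclusion (fineSelmerInfty_le_signedSelmerInfty A κ 1) s)) →
        ∀ 𝔭 : PrimeSpectrum (IwasawaAlgebra 2), 𝔭.asIdeal.height = 1 →
          PowerSeries.C (2 : ℤ_[2]) ∉ 𝔭.asIdeal →
        ∃ (I : Kato2004.IwasawaH1Data A 2 κ γ)
          (P : Type) (_ : AddCommGroup P) (_ : _root_.Module (IwasawaAlgebra 2) P)
          (ι : P →ₗ[IwasawaAlgebra 2] IwasawaAlgebra 2) (col : I.H →ₗ[IwasawaAlgebra 2] P)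
          (j : P →ₗ[IwasawaAlgebra 2] D.X) (s : I.H) (m : ℕ),
          (∀ y, j y = 0 → (PowerSeries.C (2 : ℤ_[2]) : IwasawaAlgebra 2) ^ m • y ∈ LinearMap.range col) ∧
          (∀ y, (PowerSeries.C (2 : ℤ_[2]) : IwasawaAlgebra 2) ^ m • k (j y) = 0) ∧
          lengthAt (IwasawaAlgebra 2) (IwasawaAlgebra 2 ⧸ LinearMap.range ι) 𝔭 = 0 ∧
          lengthAt (IwasawaAlgebra 2) (IwasawaAlgebra 2 ⧸ Ideal.span {kobayashiL 1 Lplus Lminus}) 𝔭 ≤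
            lengthAt (IwasawaAlgebra 2) (IwasawaAlgebra 2 ⧸ Ideal.span {ι (col s)}) 𝔭 ∧
          lengthAt (IwasawaAlgebra 2) (I.H ⧸ Submodule.span (IwasawaAlgebra 2) {s}) 𝔭 ≤
            lengthAt (IwasawaAlgebra 2) Y.X 𝔭) :
    ∀ (A : WeierstrassCurve ℚ) [A.IsElliptic] [A.IsGloballyMinimal],
      A.HasCM → A.analyticRank = 0 → GoodSS A 2 → A.frobeniusTrace 2 = 0 →
      2 ∣ A.shaOrder * A.tamagawaProduct →
      ∀ (κ : ZpExtension ℚ 2) (γ : Field.absoluteGaloisGroup ℚ),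
        κ.IsCyclotomic → κ.IsTopGenerator γ → IsCyclotomicVariable 2 γ →
      ∀ [NeZero (A.conductorNorm ℤ)] (f : CuspForm (Gamma0 (A.conductorNorm ℤ)) 2),
        IsNewformOf A f → ∀ (ϖ : ℚ), (ϖ : ℝ) * A.realPeriodRat = plusPeriod f →
      ∀ (Lplus Lminus : IwasawaAlgebra 2), IsPollackPair f 2 Lplus Lminus →
      ∀ (D : SignedSelmerDualData A κ γ 1), Module.IsTorsion (IwasawaAlgebra 2) D.X →
        ∀ 𝔭 : PrimeSpectrum (IwasawaAlgebra 2), 𝔭.asIdeal.height = 1 →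
          PowerSeries.C (2 : ℤ_[2]) ∉ 𝔭.asIdeal →
          lengthAt (IwasawaAlgebra 2) (IwasawaAlgebra 2 ⧸ Ideal.span {kobayashiL 1 Lplus Lminus}) 𝔭 ≤
            lengthAt (IwasawaAlgebra 2) D.X 𝔭 := by
  intro A _ _ hcm hr hss ha hz κ γ hκ hγ hcv _ f hf ϖ hϖ Lplus Lminus hPP D hX 𝔭 h𝔭 hp𝔭
  haveI : ContinuousSMul ℤ_[2] (A.tateModule 2) := TateModule.continuousSMul_padicInt
  obtain ⟨Y⟩ := A.nonempty_fineSelmerDualData κ hγ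
  obtain ⟨k, hk, hkY⟩ := D.exists_linearMap_toFineDual hγ Y
  obtain ⟨I, P, _, _, ι, col, j, s, m, hjc, hkj, hcoker, hdiv, hIMC⟩ :=
    hPkg A hcm hr hss ha hz κ γ hκ hγ hcv f hf ϖ hϖ Lplus Lminus hPP D hX Y k hk hkY 𝔭 h𝔭 hp𝔭
  exact lengthAt_quotient_le_of_fourTerm_ge_upTo ι col j k 𝔭 (pow_not_mem 𝔭 hp𝔭 m) hjc hkj hk s hcoker hdiv hIMC

end AtTwo

/-! ## §3 `p = 2`: the lower package in the PINNED-LOCAL-DUAL currency — `j` constructed, clause (c) proved -/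

section Pinned

/-- **Clause (c) is a theorem for transpose-type `j`.** `K = ℚ`, `p = 2`, cyclotomic `κ`, `v ∋ 2`: for a pinned dual `D` of `Sel^ε(A/ℚ_∞)`,
a fine dual datum `Y` with its transpose `k : X^ε → X₀` (`Y.toDual (k x) s = D.toDual x (incl s)`), ANY additive `r : Sel^ε_∞ → S'` that
kills the classes with `res_{Gal(ℚ̄/ℚ_∞) ⊓ D_v} = 0`, and ANY additive `j : P → X^ε` with `D.toDual (j y) s = dP y (r s)`: `k (j y) = 0`
for all `y` — fine Selmer classes are locally trivial at the prime above `2` (`FineStrictRat.resOfLe_eq_zero_of_mem_fineSelmerInfty_rat`).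
[cite: Kobayashi2003, (7.21) (p. 12)] [cite: Greenberg1989, §1 p. 98] -/
theorem comp_transpose_eq_zero_of_resOfLe {A : WeierstrassCurve ℚ} [A.IsElliptic] {κ : ZpExtension ℚ 2} (hκ : κ.IsCyclotomic)
    (v : HeightOneSpectrum (𝓞 ℚ)) (hv : ((2 : ℕ) : 𝓞 ℚ) ∈ v.asIdeal) {γ : Field.absoluteGaloisGroup ℚ} {ε : ℤˣ}
    (D : SignedSelmerDualData A κ γ ε) (Y : A.FineSelmerDualData κ γ) (k : D.X →ₗ[IwasawaAlgebra 2] Y.X)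
    (hkY : ∀ (x : D.X) (s : A.fineSelmerInfty κ),
      Y.toDual (k x) s = D.toDual x (AddSubgroup.inclusion (fineSelmerInfty_le_signedSelmerInfty A κ ε) s))
    {S' : Type*} [AddCommGroup S'] (r : signedSelmerInfty A κ ε →+ S')
    (hr0 : ∀ t : signedSelmerInfty A κ ε,
      resOfLe (A.geomPrimaryTorsion 2) (inf_le_left : κ.kerSubgroup ⊓ decomp v ≤ κ.kerSubgroup)
        (t : A.subgroupH1 2 κ.kerSubgroup) = 0 → r t = 0)
    {P : Type*} [AddCommGroup P] (dP : P →+ (S' →+ AddCircle (1 : ℚ))) (j : P →+ D.X)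
    (hj : ∀ (y : P) (s : signedSelmerInfty A κ ε), D.toDual (j y) s = dP y (r s)) (y : P) :
    k (j y) = 0 := by
  refine Y.bijective.1 (AddMonoidHom.ext fun s ↦ ?_)
  rw [hkY, hj, map_zero, AddMonoidHom.zero_apply,
    hr0 _ (SignedKatoOffTwo.FineStrictRat.resOfLe_eq_zero_of_mem_fineSelmerInfty_rat A κ hκ v hv s.2), map_zero]

/-- **(LDℓ)_A from a lower package in the PINNED-LOCAL-DUAL currency: `j` constructed, (c) proved, (PT♭) the only global clause.**
Fix a place `v ∋ 2` of `ℚ`. If for every datum as in `offTwoLower_of_lowerRobustPackageTwo` (CM `A` off the unit zone, `κ, γ`, `f`, `ϖ`,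
Pollack pair, `D` with `X⁺` torsion, fine dual datum `Y`, height-one `𝔭 ∌ 2`) there are: a pinned `I = 𝐇¹_Γ(T₂A)`; an abelian group `S'`
with an additive `r : Sel⁺(A/ℚ_∞) → S'` KILLING every class with `res_{Gal(ℚ̄/ℚ_∞) ⊓ D_v} = 0` and an endomorphism `ψ'` with
`r ∘ conj_γ = ψ' ∘ r`; a pinned local dual — a `Λ`-module `P` with `dP : P → Hom(S', ℚ/ℤ)`, `T` acting through `ψ' − 1`, constants through
`ℤ₂ → ℤ/2^k` on `2^k`-torsion; `ι : P → Λ`, `col : 𝐇¹ → P`, `s ∈ 𝐇¹`, `m`; with (PT♭) «if `dP y` vanishes on `r(Sel⁺_∞)` then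
`C(2)^m · y ∈ range col`» (the deep Poitou–Tate half at the local term of Kobayashi's (7.17)), (e) `ℓ_𝔭(Λ/ι(P)) = 0`, (f)
`ℓ_𝔭(Λ/(L♭)) ≤ ℓ_𝔭(Λ/(ι col s))`, (g) `ℓ_𝔭(𝐇¹/Λs) ≤ ℓ_𝔭(X₀)` — THEN (LDℓ)_A. Inside: `j :=` the `Λ`-linear transpose of `r`
(`SignedKatoOffTwo.LocalChar.exists_linearTranspose`), (b♭) from (PT♭) by `linearTranspose_eq_zero_iff`, (c) by
`comp_transpose_eq_zero_of_resOfLe`, then §2. [cite: Kobayashi2003, Thm. 6.2–6.3, (7.17)–(7.21), Thm. 7.3, (8.23) (pp. 11–13, 18)]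
[cite: Kato2004Asterisque, Conj. 12.10 (p. 224), Lemma 15.13 and (15.16.1) (pp. 264–265), §17.13 (p. 280)] [cite: GreenbergLNM1716, §1–2] -/
theorem offTwoLower_of_pinnedLocalDualPackageTwo (v : HeightOneSpectrum (𝓞 ℚ)) (hv : ((2 : ℕ) : 𝓞 ℚ) ∈ v.asIdeal)
    (hPkg : ∀ (A : WeierstrassCurve ℚ) [A.IsElliptic] [A.IsGloballyMinimal],
      A.HasCM → A.analyticRank = 0 → GoodSS A 2 → A.frobeniusTrace 2 = 0 →
      2 ∣ A.shaOrder * A.tamagawaProduct →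
      ∀ (κ : ZpExtension ℚ 2) (γ : Field.absoluteGaloisGroup ℚ),
        κ.IsCyclotomic → κ.IsTopGenerator γ → IsCyclotomicVariable 2 γ →
      ∀ [NeZero (A.conductorNorm ℤ)] (f : CuspForm (Gamma0 (A.conductorNorm ℤ)) 2),
        IsNewformOf A f → ∀ (ϖ : ℚ), (ϖ : ℝ) * A.realPeriodRat = plusPeriod f →
      ∀ (Lplus Lminus : IwasawaAlgebra 2), IsPollackPair f 2 Lplus Lminus →
      ∀ (D : SignedSelmerDualData A κ γ 1) [ContinuousSMul ℤ_[2] (A.tateModule 2)],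
        Module.IsTorsion (IwasawaAlgebra 2) D.X →
      ∀ (Y : A.FineSelmerDualData κ γ),
        ∀ 𝔭 : PrimeSpectrum (IwasawaAlgebra 2), 𝔭.asIdeal.height = 1 →
          PowerSeries.C (2 : ℤ_[2]) ∉ 𝔭.asIdeal →
        ∃ (I : Kato2004.IwasawaH1Data A 2 κ γ)
          (S' : Type) (_ : AddCommGroup S') (r : signedSelmerInfty A κ 1 →+ S') (ψ' : S' →+ S')
          (P : Type) (_ : AddCommGroup P) (_ : _root_.Module (IwasawaAlgebra 2) P)
          (dP : P →+ (S' →+ AddCircle (1 : ℚ)))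
          (ι : P →ₗ[IwasawaAlgebra 2] IwasawaAlgebra 2) (col : I.H →ₗ[IwasawaAlgebra 2] P) (s : I.H) (m : ℕ),
          (∀ t : signedSelmerInfty A κ 1,
            resOfLe (A.geomPrimaryTorsion 2) (inf_le_left : κ.kerSubgroup ⊓ decomp v ≤ κ.kerSubgroup)
              (t : A.subgroupH1 2 κ.kerSubgroup) = 0 → r t = 0) ∧
          (∀ t : signedSelmerInfty A κ 1, r (conjSignedSelmerInfty A κ 1 γ t) = ψ' (r t)) ∧
          (∀ (y : P) (t : S'), dP ((PowerSeries.X : IwasawaAlgebra 2) • y) t = dP y (ψ' t) - dP y t) ∧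
          (∀ (c : ℤ_[2]) (y : P) (t : S') (n : ℕ), 2 ^ n • t = 0 →
            dP ((PowerSeries.C c : IwasawaAlgebra 2) • y) t = (PadicInt.toZModPow n c).val • dP y t) ∧
          (∀ y : P, (∀ t : signedSelmerInfty A κ 1, dP y (r t) = 0) →
            (PowerSeries.C (2 : ℤ_[2]) : IwasawaAlgebra 2) ^ m • y ∈ LinearMap.range col) ∧
          lengthAt (IwasawaAlgebra 2) (IwasawaAlgebra 2 ⧸ LinearMap.range ι) 𝔭 = 0 ∧
          lengthAt (IwasawaAlgebra 2) (IwasawaAlgebra 2 ⧸ Ideal.span {kobayashiL 1 Lplus Lminus}) 𝔭 ≤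
            lengthAt (IwasawaAlgebra 2) (IwasawaAlgebra 2 ⧸ Ideal.span {ι (col s)}) 𝔭 ∧
          lengthAt (IwasawaAlgebra 2) (I.H ⧸ Submodule.span (IwasawaAlgebra 2) {s}) 𝔭 ≤
            lengthAt (IwasawaAlgebra 2) Y.X 𝔭) :
    ∀ (A : WeierstrassCurve ℚ) [A.IsElliptic] [A.IsGloballyMinimal],
      A.HasCM → A.analyticRank = 0 → GoodSS A 2 → A.frobeniusTrace 2 = 0 →
      2 ∣ A.shaOrder * A.tamagawaProduct →
      ∀ (κ : ZpExtension ℚ 2) (γ : Field.absoluteGaloisGroup ℚ),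
        κ.IsCyclotomic → κ.IsTopGenerator γ → IsCyclotomicVariable 2 γ →
      ∀ [NeZero (A.conductorNorm ℤ)] (f : CuspForm (Gamma0 (A.conductorNorm ℤ)) 2),
        IsNewformOf A f → ∀ (ϖ : ℚ), (ϖ : ℝ) * A.realPeriodRat = plusPeriod f →
      ∀ (Lplus Lminus : IwasawaAlgebra 2), IsPollackPair f 2 Lplus Lminus →
      ∀ (D : SignedSelmerDualData A κ γ 1), Module.IsTorsion (IwasawaAlgebra 2) D.X →
        ∀ 𝔭 : PrimeSpectrum (IwasawaAlgebra 2), 𝔭.asIdeal.height = 1 →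
          PowerSeries.C (2 : ℤ_[2]) ∉ 𝔭.asIdeal →
          lengthAt (IwasawaAlgebra 2) (IwasawaAlgebra 2 ⧸ Ideal.span {kobayashiL 1 Lplus Lminus}) 𝔭 ≤
            lengthAt (IwasawaAlgebra 2) D.X 𝔭 := by
  refine offTwoLower_of_lowerRobustPackageTwo
    fun A _ _ hcm hr hss ha hz κ γ hκ hγ hcv _ f hf ϖ hϖ Lplus Lminus hPP D _ hX Y k hk hkY 𝔭 h𝔭 hp𝔭 ↦ ?_
  obtain ⟨I, S', _, r, ψ', P, _, _, dP, ι, col, s, m, hr0, hr, hT, hC, hPT, hcoker, hdiv, hIMC⟩ :=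
    hPkg A hcm hr hss ha hz κ γ hκ hγ hcv f hf ϖ hϖ Lplus Lminus hPP D hX Y 𝔭 h𝔭 hp𝔭
  obtain ⟨j, hj⟩ := SignedKatoOffTwo.LocalChar.exists_linearTranspose A 2 κ 1 D r dP ψ' hr hT
    (fun c y t n hn ↦ hC c y t n (by exact_mod_cast hn))
  refine ⟨I, P, inferInstance, inferInstance, ι, col, j, s, m, fun y hy ↦ hPT y ?_, fun y ↦ ?_, hcoker, hdiv, hIMC⟩
  · exact (SignedKatoOffTwo.LocalChar.linearTranspose_eq_zero_iff A 2 κ 1 D r dP j hj y).1 hy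
  · have h0 : k (j y) = 0 :=
      comp_transpose_eq_zero_of_resOfLe hκ v hv D Y k hkY r hr0 dP j.toAddMonoidHom (fun y s ↦ hj y s) y
    rw [h0, smul_zero]

end Pinned

end SignedLowerOffTwo

end Summit.BirchSwinnertonDyer.BirchSwinnertonDyer.Theorems

end
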